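import Mathlib
import Summits.ValiantsHypothesis.ValiantsHypothesis.Theses.ValuativeGCT
import Literature.NumberTheory.DiophantineGeometry.DetStabilizerFrobeniusProofs

/-!
# `ValuativeGCT.ValuativeFlip` (stmt-ValiantsHypothesis-12624), line skew-restriction-rank —
# the HARD half of Frobenius in the route's conventions: explicit invariants are abstract invariants

Companion of `Theorems/ValuativeGCTValuativeFlipStabInvLeExplicit.lean` (stub 1, the easy half).  A function on
`End(ℂ^{m×m})` (variables `X (j, i)`, row slot `j : MatIdx m`, matrix position `i : MatIdx m = Fin m ×ₗ Fin m`)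
invariant under the row-wise unimodular sandwiches `X_j ↦ P X_j Q` (`det P = det Q = 1`) and under the row-wise
transpose `X_j ↦ X_jᵀ` is invariant under the row action `φ_M : X (j, i) ↦ ∑_l M l i • X (j, l)` of EVERY `M`
in the `End`-stabiliser of `det_m` (`linSubst M det_m = det_m`), because by Frobenius' determinant-preserver
theorem in the Marcus–Moyls form (tree: `frobenius_detPreserver_unimodular_sandwich_holds`) such an `M` acts
as `X ↦ P X Q` or `X ↦ P Xᵀ Q` with `det P = det Q = 1`; reading off matrix entries at the standard basis,
`M` IS the sandwich matrix `M l i = P i₁ l₁ * Q l₂ i₂` (`eq_sandwichMatrix_of_forall`), resp. the twisted one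
`M l i = P i₁ l₂ * Q l₁ i₂`, whose row action is `φ_τ ∘ φ_{P,Q}` (`aeval_twisted_eq_comp`).  Together with
stub 1 this gives the EQUALITY of the crux's third factor with the line's explicit invariants
(`stabInv_eq_explicit`): the untruncated space `T₀(λ)` of the route is the explicit space `E(λ)` of the line,
so `dim E(λ) = sk(λ; δ^m)` exactly and the census currency loses nothing.  [Frobenius 1897; Marcus–Moyls 1959
Thm 2; BLMW 2011 §5.2]
-/

namespace Summit.ValiantsHypothesis.ValiantsHypothesis.Theorems.ValuativeFlip

open Literature.NumberTheory.DiophantineGeometry Literature.Computability.AlgebraicComplexity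
open MvPolynomial
open scoped BigOperators Matrix

-- `Summit.ValiantsHypothesis.ValiantsHypothesis.…` is the tree's mandated single-conjunct layout (Sub = Summit).
set_option linter.dupNamespace false

noncomputable section

/-- Entries of `mat (Mᵀ · e_l)`: `(Mᵀ *ᵥ Pi.single l 1) i = M l i`. [folklore] -/
theorem transpose_mulVec_single {m : ℕ} (M : Matrix (MatIdx m) (MatIdx m) ℂ) (l i : MatIdx m) :
    (Mᵀ *ᵥ Pi.single l (1 : ℂ)) i = M l i := by
  simp [Matrix.mulVec, dotProduct, Pi.single_apply, Matrix.transpose_apply]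

/-- Entries of a sandwiched elementary matrix: `(P E_{cd} Q)_{ab} = P_{ac} Q_{db}`. [folklore] -/
theorem sandwich_single_apply {m : ℕ} (P Q : Matrix (Fin m) (Fin m) ℂ) (c d a b : Fin m) :
    (P * Matrix.single c d (1 : ℂ) * Q) a b = P a c * Q d b := by
  rw [Matrix.mul_apply, Finset.sum_eq_single d]
  · rw [Matrix.mul_apply, Finset.sum_eq_single c]
    · simp
    · intro x _ hx
      simp [Ne.symm hx]
    · simp
  · intro y _ hy
    rw [Matrix.mul_apply, Finset.sum_eq_zero, zero_mul]
    intro x _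
    simp [Ne.symm hy]
  · simp

/-- The matrix of the basis vector `e_{(c,d)}` is the elementary matrix `E_{cd}`. [folklore] -/
theorem of_single_eq {m : ℕ} (c d : Fin m) :
    (Matrix.of fun a b : Fin m => (Pi.single (toLex (c, d)) (1 : ℂ) : MatIdx m → ℂ) (toLex (a, b))) =
      Matrix.single c d (1 : ℂ) := by
  ext a b
  rw [Matrix.of_apply, Matrix.single_apply]
  by_cases h : c = a ∧ d = b
  · obtain ⟨rfl, rfl⟩ := h
    rw [if_pos ⟨rfl, rfl⟩, Pi.single_eq_same]
  · rw [if_neg h, Pi.single_eq_of_ne]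
    intro hab
    apply h
    have := toLex.injective hab
    simp only [Prod.mk.injEq] at this
    exact ⟨this.1.symm, this.2.symm⟩

/-- **Reading off a sandwich.**  If `mat (Mᵀ x) = P · mat x · Q` for all `x`, then `M` is the sandwich matrix
`M l i = P i₁ l₁ * Q l₂ i₂`. [folklore] -/
theorem eq_sandwichMatrix_of_forall {m : ℕ} {M : Matrix (MatIdx m) (MatIdx m) ℂ} {P Q : Matrix (Fin m) (Fin m) ℂ}
    (h : ∀ x : MatIdx m → ℂ, (Matrix.of fun a b => (Mᵀ *ᵥ x) (toLex (a, b))) =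
      P * (Matrix.of fun a b => x (toLex (a, b))) * Q) :
    M = Matrix.of fun l i : MatIdx m => P (ofLex i).1 (ofLex l).1 * Q (ofLex l).2 (ofLex i).2 := by
  ext l i
  have hx := congrFun (congrFun (h (Pi.single l 1)) (ofLex i).1) (ofLex i).2
  rw [Matrix.of_apply] at hx
  have hl : l = toLex ((ofLex l).1, (ofLex l).2) := rfl
  have hi : (toLex ((ofLex i).1, (ofLex i).2) : MatIdx m) = i := rfl
  rw [hi, transpose_mulVec_single] at hx
  rw [hx, Matrix.of_apply, hl, of_single_eq, sandwich_single_apply]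
  rfl

/-- **Reading off a twisted sandwich.**  If `mat (Mᵀ x) = P · (mat x)ᵀ · Q` for all `x`, then
`M l i = P i₁ l₂ * Q l₁ i₂`. [folklore] -/
theorem eq_twistedMatrix_of_forall {m : ℕ} {M : Matrix (MatIdx m) (MatIdx m) ℂ} {P Q : Matrix (Fin m) (Fin m) ℂ}
    (h : ∀ x : MatIdx m → ℂ, (Matrix.of fun a b => (Mᵀ *ᵥ x) (toLex (a, b))) =
      P * (Matrix.of fun a b => x (toLex (a, b)))ᵀ * Q) :
    M = Matrix.of fun l i : MatIdx m => P (ofLex i).1 (ofLex l).2 * Q (ofLex l).1 (ofLex i).2 := by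
  ext l i
  have hx := congrFun (congrFun (h (Pi.single l 1)) (ofLex i).1) (ofLex i).2
  rw [Matrix.of_apply] at hx
  have hl : l = toLex ((ofLex l).1, (ofLex l).2) := rfl
  have hi : (toLex ((ofLex i).1, (ofLex i).2) : MatIdx m) = i := rfl
  rw [hi, transpose_mulVec_single] at hx
  rw [hx, Matrix.of_apply, hl, of_single_eq, Matrix.transpose_single, sandwich_single_apply]
  rfl

/-- The row action of a twisted sandwich matrix is the sandwich substitution followed by the row-wise transpose
(as algebra endomorphisms of `ℂ[End W]`). [folklore] -/
theorem aeval_twisted_eq_comp {m : ℕ} (P Q : Matrix (Fin m) (Fin m) ℂ) :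
    (MvPolynomial.aeval fun p : MatIdx m × MatIdx m =>
        ∑ l : MatIdx m, (Matrix.of fun l i : MatIdx m => P (ofLex i).1 (ofLex l).2 * Q (ofLex l).1 (ofLex i).2) l p.2 •
          (MvPolynomial.X (p.1, l) : MvPolynomial (MatIdx m × MatIdx m) ℂ)) =
      (MvPolynomial.aeval fun p : MatIdx m × MatIdx m =>
          (MvPolynomial.X (p.1, toLex ((ofLex p.2).2, (ofLex p.2).1)) : MvPolynomial (MatIdx m × MatIdx m) ℂ)).comp
        (MvPolynomial.aeval fun p : MatIdx m × MatIdx m =>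
          ∑ l : MatIdx m, (P (ofLex p.2).1 (ofLex l).1 * Q (ofLex l).2 (ofLex p.2).2) •
            (MvPolynomial.X (p.1, l) : MvPolynomial (MatIdx m × MatIdx m) ℂ)) := by
  refine MvPolynomial.algHom_ext fun p => ?_
  rw [AlgHom.comp_apply, aeval_X, aeval_X, map_sum]
  simp only [map_smul, aeval_X, Matrix.of_apply]
  -- reindex the right-hand sum along the index transposition `l ↦ swap l`
  let sw : MatIdx m ≃ MatIdx m :=
    { toFun := fun l => toLex ((ofLex l).2, (ofLex l).1)
      invFun := fun l => toLex ((ofLex l).2, (ofLex l).1)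
      left_inv := fun l => rfl
      right_inv := fun l => rfl }
  rw [← Equiv.sum_comp sw]
  rfl

/-- **The hard half of Frobenius in the route's conventions: explicit invariants are abstract
`Stab_End(det_m)`-invariants.**  `sandInv ∩ trInv ≤ stabInv`, all three written verbatim as in the crux / the line
(with type ascriptions). [Frobenius 1897; Marcus–Moyls 1959, Thm 2; BLMW 2011 §5.2] -/
theorem explicit_le_stabInv (m : ℕ) :
    (⨅ (P : Matrix (Fin m) (Fin m) ℂ) (Q : Matrix (Fin m) (Fin m) ℂ) (_ : P.det = 1)
          (_ : Q.det = 1),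
        LinearMap.ker ((MvPolynomial.aeval fun p : MatIdx m × MatIdx m =>
            ∑ l : MatIdx m, (P (ofLex p.2).1 (ofLex l).1 * Q (ofLex l).2 (ofLex p.2).2) •
              (MvPolynomial.X (p.1, l) : MvPolynomial (MatIdx m × MatIdx m) ℂ)).toLinearMap -
          (LinearMap.id : MvPolynomial (MatIdx m × MatIdx m) ℂ →ₗ[ℂ] MvPolynomial (MatIdx m × MatIdx m) ℂ))) ⊓
      LinearMap.ker ((MvPolynomial.aeval fun p : MatIdx m × MatIdx m =>
          (MvPolynomial.X (p.1, toLex ((ofLex p.2).2, (ofLex p.2).1)) :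
            MvPolynomial (MatIdx m × MatIdx m) ℂ)).toLinearMap -
        (LinearMap.id : MvPolynomial (MatIdx m × MatIdx m) ℂ →ₗ[ℂ] MvPolynomial (MatIdx m × MatIdx m) ℂ))
    ≤ (⨅ (M : Matrix (MatIdx m) (MatIdx m) ℂ)
        (_ : linSubst (MatIdx m) ℂ M (detFormLex ℂ m) = detFormLex ℂ m),
        LinearMap.ker ((MvPolynomial.aeval fun p : MatIdx m × MatIdx m =>
            ∑ l : MatIdx m, M l p.2 •
              (MvPolynomial.X (p.1, l) : MvPolynomial (MatIdx m × MatIdx m) ℂ)).toLinearMap -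
          (LinearMap.id : MvPolynomial (MatIdx m × MatIdx m) ℂ →ₗ[ℂ] MvPolynomial (MatIdx m × MatIdx m) ℂ))) := by
  intro G hG
  rw [Submodule.mem_inf] at hG
  obtain ⟨hGs, hGt⟩ := hG
  simp only [Submodule.mem_iInf, LinearMap.mem_ker, LinearMap.sub_apply, sub_eq_zero,
    AlgHom.toLinearMap_apply, LinearMap.id_coe, id_eq] at hGs hGt ⊢
  intro M hM
  obtain ⟨P, Q, hP, hQ, h⟩ := frobenius_detPreserver_unimodular_sandwich_holds m M hM
  rcases h with h | h
  · rw [eq_sandwichMatrix_of_forall h]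
    simpa only [Matrix.of_apply] using hGs P Q hP hQ
  · rw [eq_twistedMatrix_of_forall h, aeval_twisted_eq_comp, AlgHom.comp_apply, hGs P Q hP hQ, hGt]

end

end Summit.ValiantsHypothesis.ValiantsHypothesis.Theorems.ValuativeFlip
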